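import Literature.NumberTheory.LFunctions.VinogradovKorobovInputs
import Literature.NumberTheory.LFunctions.RiemannSiegelStirling
import HarnessLib

/-!
# Explicit `N(T)` versus `S(T)`: the zero-counting bound of Hasanalizade–Shen–Wong reduced to its two inputs

Topic `Literature/NumberTheory/LFunctions`; companion of `VinogradovKorobovInputs.lean` (whose sibling
`VinogradovKorobovInputsProofs.lean` discharges Ramaré's bound (3.2)), which vendors the bound (3.8)
of Mossinghoff–Trudgian–Yang,
`|N(T) − (T/2π) log(T/2πe)| ≤ 0.1038 log T + 0.2573 log log T + 9.3675` (`T ≥ e`), as the named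
fact `Literature.NumberTheory.LFunctions.zetaZeroCount_hasanalizade_shen_wong` = Corollary 1.2 of
Hasanalizade–Shen–Wong, *J. Number Theory* 235 (2022) 219–241 = arXiv:2107.06506 (numbering of
theorems, equations `(n.m)` and tables identical in both versions).

## The printed proof of Corollary 1.2, and what is proved here

The source proves Corollary 1.2 in two ranges (§5, proof of Corollary 1.2, (5.5)–(5.6)):

* **`T ≥ T₀ := 30 610 046 000`** (the height of Platt's rigorous database of the first
  `103 800 788 359` zeros): from its main theorems. Theorem 1.1 bounds
  `|N(T) − (T/2π) log(T/2πe) + 1/8| ≤ C₁ log T + C₂ log log T + C₃` and Theorem 1.3 bounds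
  `|S(T)| ≤ C₁ log T + C₂ log log T + C₃'` for `T ≥ T₀`, for admissible parameters `(c, r, η)` and
  given bounds for `ζ` on the `1`- and `½`-lines (Patel: `|ζ(1+it)| ≤ log t`, `t ≥ 3`; Hiary–Patel:
  `|ζ(½+it)| ≤ 0.77 t^{1/6} log t`, `t ≥ 3`); Table 2, row 1
  (`(c, r, η) = (1.000011314, 1.064340602, 4.2826451·10⁻⁶)`, `T₀ = 30 610 046 000`, `J₁ = 64`,
  `J₂ = 39`) gives `(C₁, C₂, C₃, C₃') = (0.103787, 0.257297, 9.367419, 8.367419)`. The proof is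
  Backlund's method in the form of Bennett–Martin–O'Bryant–Rechnitzer: the argument principle for
  `ξ`, an explicit Stirling bound `|g(T)| ≤ 1/(25T)` for the `Γ`-factor ((2.6)–(2.7)), Jensen's
  formula on discs `D(c, r)` (Prop. 3.1), Backlund's trick (Prop. 3.2), Trudgian's
  Phragmén–Lindelöf principle (Prop. 4.1) with six ranges of convexity bounds (§4.1), and a
  numerical optimisation of the resulting integrals (§4.2, §5, (5.1)–(5.4), (5.7)).
* **`e ≤ T ≤ T₀`**: from the identity (5.5), `S(T) = N(T) − (T/2π) log(T/2πe) + 1/8 − g(T)/2 − 1`,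
  the bound `|g(T)| ≤ 1/(25T)` and the *computational* input (1.7): `|S(T)| ≤ 2.5167` for
  `0 ≤ T ≤ 30 610 046 000`, "confirmed using the database of non-trivial zeros of `ζ(s)` computed
  by Platt" (Platt 2017; LMFDB).

This file proves the deduction of Corollary 1.2 from these two inputs, in the tree's
normalisation, with the inputs as explicit hypotheses (no new named facts):

* `zetaZeroCount_sub_main_eq` — (5.5): `N(T) − (T/2π) log(T/2πe) = S(T) + 7/8 + (θ(T) − Θ(T))/π`
  for `T > 0`, where `Θ(T) = (T/2) log(T/2π) − T/2 − π/8` is Stirling's main term for the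
  Riemann–Siegel theta function `θ` (the last summand is the source's `g(T)/2`);
* `abs_zetaZeroCount_sub_main_sub_zetaArgS_le` — `|N(T) − (T/2π) log(T/2πe) − S(T) − 7/8| ≤ 1.2/(πT)`
  for `T ≥ 2`, from the tree's *proved* explicit Stirling bound `|θ(T) − Θ(T)| ≤ 2K(¼)/T`
  (`abs_riemannSiegelTheta_sub_stirling_le`, `K(¼) = stirlingVertRate ¼ < 0.6`), in place of the
  source's (2.7);
* `abs_zetaZeroCount_sub_main_le_of_abs_zetaArgS_le`, `abs_zetaArgS_le_of_abs_zetaZeroCount_sub_main_le`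
  — hence bounds for `|S(T)|` and for `|N(T) − (T/2π) log(T/2πe)|` differ by at most
  `7/8 + 1.2/(πT)`, in both directions;
* `zetaZeroCount_hasanalizade_shen_wong_of_zetaArgS_bounds` — **Corollary 1.2 from Theorem 1.3 (at
  Table 2, row 1, `T ≥ T₀`) and (1.7) (on `e ≤ T ≤ T₀`)**;
* `abs_zetaArgS_le_hasanalizade_shen_wong_of_zetaArgS_bounds` — likewise the first branch of
  Corollary 1.4, `|S(T)| ≤ 0.1038 log T + 0.2573 log log T + 8.3675` (`T ≥ e`);
* `abs_zetaArgS_le_of_zetaZeroCount_hasanalizade_shen_wong` — conversely, the named fact gives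
  `|S(T)| ≤ 0.1038 log T + 0.2573 log log T + 10.3831` for `T ≥ e`.

What is *not* proved here is either input: Theorem 1.3 rests on the explicit van der Corput bound
`|ζ(½+it)| ≤ 0.77 t^{1/6} log t` (`t ≥ 3`) of Hiary (as corrected by Patel), of which the tree has
only the qualitative form `‖ζ(½+it)‖ ≤ C t^{1/6} log t` with an unspecified `C`
(`norm_riemannZeta_half_le_weyl`, `ZetaWeylBound.lean`) — by (5.1), (5.4) of the source `C₃`
grows by `0.119` per unit of `log k₁` at the parameters of Table 2, row 1, against a slack of
`9.3675 − 9.2425 = 0.125` (so `k₁ ≤ 2.2` is needed), and `C₁ = 0.1038` "is the smallest value that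
can be obtained by [the] argument", with `k₂ = 1/6` — and (1.7) is a statement about `≈ 10¹¹`
zeros.

## Faithfulness notes

1. **`S(T)` of the source is the tree's `zetaArgS`.** The source sets
   `S(T) = (1/π) Δ_L arg ζ(s)` along `2 → 2 + iT → ½ + iT` and records (5.5)
   `S(T) = ½ (N_ℚ(T) − (T/π) log(T/2πe) + ¼ − g(T) − 2)` with `N_ℚ(T) = 2N(T)` and
   `g(T) = (2/π) Im log Γ(¼ + iT/2) − (T/π) log(T/2e) + ¼` ((2.6), continuous branch vanishing at
   `T = 0`); unwinding, `(T/2π) log(T/2πe) − 1/8 + g(T)/2 = θ(T)/π` with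
   `θ(T) = Im log Γ(¼ + iT/2) − (T/2) log π` the Riemann–Siegel theta function (continuous branch,
   `θ(0) = 0`, the tree's `riemannSiegelTheta`, an integral of its derivative), so (5.5) reads
   `S(T) = N(T) − θ(T)/π − 1`, which is the *definition* of `zetaArgS`
   (`zetaZeroCount_eq_theta_add_zetaArgS`). The source's `N(T)` counts `0 < γ ≤ T` by the argument
   principle, i.e. with multiplicity and right-continuously, as `zetaZeroCount` does.
2. **Which theorem the large range uses.** The printed proof of Corollary 1.2 opens "By Theorem 1.1
   (with `T₀ = 30 610 046 000` and Table 2), it is sufficient to verify the corollary for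
   `e ≤ T ≤ 30 610 046 000`". Literally, Theorem 1.1 with `C₃ = 9.367419` bounds `|N − M + 1/8|`
   (`M` the main term), whence only `|N − M| ≤ … + 9.492419` by the triangle inequality, not the
   printed `9.3675`. The corollary does follow — with room — from the paper's **Theorem 1.3**
   (`C₃' = 8.367419`, (5.7): `C₃' = C₃ − 1 + (1/π)(arctan((σ₁−1)/T₀) + arctan(1/(2T₀)))`) and
   (5.5): `|N − M| = |S + 7/8 + g/2| ≤ 0.103787 log T + 0.257297 log log T + 8.367419 + 0.875 + 1.2/(πT₀)`,
   and `9.2425 ≤ 9.3675`; Corollary 1.4 of the source is obtained from Theorem 1.3 in exactly this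
   way. The hypotheses of `zetaZeroCount_hasanalizade_shen_wong_of_zetaArgS_bounds` are therefore
   Theorem 1.3 at Table 2, row 1 (digit for digit) and (1.7) restricted to `T ≥ e`.

## References

* E. Hasanalizade, Q. Shen, P.-J. Wong, *Counting zeros of the Riemann zeta function*, J. Number
  Theory 235 (2022) 219–241 = arXiv:2107.06506: Thm. 1.1 (1.4), Cor. 1.2 (1.5), Thm. 1.3 (1.6),
  eq. (1.7), Cor. 1.4; §2 (2.6)–(2.8); §5 (5.1)–(5.7), Table 2 (`HasanalizadeShenWong2022`).
* D. J. Platt, *Isolating some non-trivial zeros of zeta*, Math. Comp. 86 (2017) 2449–2467 — the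
  database of zeros below `30 610 046 000` behind (1.7) (`Platt2017`).
* M. J. Mossinghoff, T. S. Trudgian, A. Yang, Res. Number Theory 10 (2024), (3.8) — the user of
  Corollary 1.2 in the tree (`MossinghoffTrudgianYangRNT2024`).
-/

noncomputable section

open Real

namespace Literature.NumberTheory.LFunctions

/-! ## The identity (5.5) in the tree's normalisation, and the `Γ`-factor error -/

/-- (5.5) of the source in the tree's normalisation: for `T > 0`,
`N(T) − (T/2π) log(T/2πe) = S(T) + 7/8 + (θ(T) − ((T/2) log(T/2π) − T/2 − π/8))/π`
(the last term is the source's `g(T)/2`). From `N = θ/π + 1 + S` (definition of `zetaArgS`) and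
`log(T/2πe) = log(T/2π) − 1`. [cite: HasanalizadeShenWong2022, (5.5)] -/
theorem zetaZeroCount_sub_main_eq {T : ℝ} (hT : 0 < T) :
    (zetaZeroCount T : ℝ) - T / (2 * π) * Real.log (T / (2 * π * Real.exp 1))
      = zetaArgS T + 7 / 8
        + (riemannSiegelTheta T - (T / 2 * Real.log (T / (2 * π)) - T / 2 - π / 8)) / π := by
  have hπ : (π : ℝ) ≠ 0 := Real.pi_ne_zero
  have h2π : 0 < 2 * π := by positivity
  have hlog : Real.log (T / (2 * π * Real.exp 1)) = Real.log (T / (2 * π)) - 1 := by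
    rw [← div_div, Real.log_div (div_pos hT h2π).ne' (Real.exp_pos 1).ne', Real.log_exp]
  rw [hlog, zetaZeroCount_eq_theta_add_zetaArgS]
  field_simp
  ring

/-- The Stirling rate `K(¼) = 1/6 + π/12 + 1/32 + 1/8` of the tree's explicit Stirling bound for `θ`
is `< 0.6`. [folklore] -/
theorem stirlingVertRate_quarter_lt : stirlingVertRate (1 / 4) < 0.6 := by
  rw [stirlingVertRate]
  have := Real.pi_lt_d2
  nlinarith

/-- **The `Γ`-factor error, explicitly** (the role of (2.7), `|g(T)| ≤ 1/(25T)`, in the source; here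
from the tree's `abs_riemannSiegelTheta_sub_stirling_le`): for `T ≥ 2`,
`|N(T) − (T/2π) log(T/2πe) − S(T) − 7/8| ≤ 1.2/(πT)`.
[cite: HasanalizadeShenWong2022, (5.5) and (2.7)] -/
theorem abs_zetaZeroCount_sub_main_sub_zetaArgS_le {T : ℝ} (hT : 2 ≤ T) :
    |(zetaZeroCount T : ℝ) - T / (2 * π) * Real.log (T / (2 * π * Real.exp 1))
        - zetaArgS T - 7 / 8| ≤ 1.2 / (π * T) := by
  have hπ := Real.pi_pos
  have hT0 : 0 < T := by linarith
  rw [zetaZeroCount_sub_main_eq hT0]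
  have hθ := abs_riemannSiegelTheta_sub_stirling_le hT
  have hK := stirlingVertRate_quarter_lt
  have e : zetaArgS T + 7 / 8
      + (riemannSiegelTheta T - (T / 2 * Real.log (T / (2 * π)) - T / 2 - π / 8)) / π
      - zetaArgS T - 7 / 8
      = (riemannSiegelTheta T - (T / 2 * Real.log (T / (2 * π)) - T / 2 - π / 8)) / π := by ring
  rw [e, abs_div, abs_of_pos hπ, div_le_iff₀ hπ]
  calc |riemannSiegelTheta T - (T / 2 * Real.log (T / (2 * π)) - T / 2 - π / 8)|
      ≤ 2 * stirlingVertRate (1 / 4) / T := hθ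
    _ ≤ 1.2 / T := by
        apply div_le_div_of_nonneg_right _ hT0.le
        linarith
    _ = 1.2 / (π * T) * π := by
        field_simp

/-- From a bound for `|S(T)|` to a bound for `|N(T) − (T/2π) log(T/2πe)|` (`T ≥ 2`): the two
differ by at most `7/8 + 1.2/(πT)` (the step (5.6) of the source, with the tree's Stirling
constant). [cite: HasanalizadeShenWong2022, (5.5)–(5.6)] -/
theorem abs_zetaZeroCount_sub_main_le_of_abs_zetaArgS_le {T B : ℝ} (hT : 2 ≤ T)
    (hS : |zetaArgS T| ≤ B) :
    |(zetaZeroCount T : ℝ) - T / (2 * π) * Real.log (T / (2 * π * Real.exp 1))|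
      ≤ B + 7 / 8 + 1.2 / (π * T) := by
  have hE := abs_zetaZeroCount_sub_main_sub_zetaArgS_le hT
  set D : ℝ := (zetaZeroCount T : ℝ) - T / (2 * π) * Real.log (T / (2 * π * Real.exp 1))
  have h1 := abs_add_le (D - zetaArgS T - 7 / 8) (zetaArgS T + 7 / 8)
  have e : D - zetaArgS T - 7 / 8 + (zetaArgS T + 7 / 8) = D := by ring
  rw [e] at h1
  have h78 : |zetaArgS T + 7 / 8| ≤ |zetaArgS T| + 7 / 8 := by
    have := abs_add_le (zetaArgS T) (7 / 8)
    rwa [abs_of_pos (by norm_num : (0 : ℝ) < 7 / 8)] at this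
  linarith

/-- From a bound for `|N(T) − (T/2π) log(T/2πe)|` to a bound for `|S(T)|` (`T ≥ 2`): the two
differ by at most `7/8 + 1.2/(πT)`. [cite: HasanalizadeShenWong2022, (5.5)] -/
theorem abs_zetaArgS_le_of_abs_zetaZeroCount_sub_main_le {T B : ℝ} (hT : 2 ≤ T)
    (hN : |(zetaZeroCount T : ℝ) - T / (2 * π) * Real.log (T / (2 * π * Real.exp 1))| ≤ B) :
    |zetaArgS T| ≤ B + 7 / 8 + 1.2 / (π * T) := by
  have hE := abs_zetaZeroCount_sub_main_sub_zetaArgS_le hT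
  set D : ℝ := (zetaZeroCount T : ℝ) - T / (2 * π) * Real.log (T / (2 * π * Real.exp 1))
  have h1 := abs_sub (D - 7 / 8) (D - zetaArgS T - 7 / 8)
  have e : D - 7 / 8 - (D - zetaArgS T - 7 / 8) = zetaArgS T := by ring
  rw [e] at h1
  have h78 : |D - 7 / 8| ≤ |D| + 7 / 8 := by
    have := abs_sub D (7 / 8)
    rwa [abs_of_pos (by norm_num : (0 : ℝ) < 7 / 8)] at this
  linarith

/-! ## Corollary 1.2 and Corollary 1.4 (first branch) from the two inputs -/

/-- `log T ≥ 1` and `log log T ≥ 0` for `T ≥ e`. [folklore] -/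
theorem one_le_log_of_exp_one_le {T : ℝ} (hT : Real.exp 1 ≤ T) :
    1 ≤ Real.log T ∧ 0 ≤ Real.log (Real.log T) := by
  have h1 : 1 ≤ Real.log T := by
    rw [← Real.log_exp 1]
    exact Real.log_le_log (Real.exp_pos 1) hT
  exact ⟨h1, Real.log_nonneg h1⟩

/-- **Corollary 1.2 of Hasanalizade–Shen–Wong from its two inputs** (the source's proof, §5,
(5.5)–(5.6), with Theorem 1.3 in the large range — note 2 of the module docstring — and the tree's
proved Stirling bound for `θ` in place of (2.7)). The hypotheses are, verbatim in the tree's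
normalisation `S = zetaArgS`: `h₁` = **Theorem 1.3** of the source at Table 2, row 1
(`T₀ = 30 610 046 000`, `(C₁, C₂, C₃') = (0.103787, 0.257297, 8.367419)`), and `h₂` = the database
bound **(1.7)**, `|S(T)| ≤ 2.5167`, on the sub-range `e ≤ T ≤ 30 610 046 000` of its printed range
`0 ≤ T ≤ 30 610 046 000`. Conclusion: the named fact `zetaZeroCount_hasanalizade_shen_wong`,
`|N(T) − (T/2π) log(T/2πe)| ≤ 0.1038 log T + 0.2573 log log T + 9.3675` for all `T ≥ e`. In the
range `e ≤ T ≤ T₀` the left side is at most `2.5167 + 7/8 + 1.2/(πe) < 3.54`; for `T ≥ T₀` it is at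
most `0.103787 log T + 0.257297 log log T + 8.367419 + 7/8 + 1.2/(πT₀)`.
[cite: HasanalizadeShenWong2022, Corollary 1.2 (proof, §5, (5.5)–(5.6)), Theorem 1.3, (1.7)] -/
theorem zetaZeroCount_hasanalizade_shen_wong_of_zetaArgS_bounds
    (h₁ : ∀ T : ℝ, 30610046000 ≤ T →
      |zetaArgS T| ≤ 0.103787 * Real.log T + 0.257297 * Real.log (Real.log T) + 8.367419)
    (h₂ : ∀ T : ℝ, Real.exp 1 ≤ T → T ≤ 30610046000 → |zetaArgS T| ≤ 2.5167) :
    zetaZeroCount_hasanalizade_shen_wong := by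
  intro T hT
  have he := Real.exp_one_gt_d9
  have hπ3 := Real.pi_gt_three
  have hπ := Real.pi_pos
  have hT2 : 2 ≤ T := by linarith
  obtain ⟨hL1, hLL0⟩ := one_le_log_of_exp_one_le hT
  rcases le_or_gt T 30610046000 with hsmall | hlarge
  · -- `e ≤ T ≤ T₀`: the database bound; the `Γ`-factor error is `≤ 1.2/(3e) < 0.15`
    have hErr : 1.2 / (π * T) ≤ 0.15 := by
      rw [div_le_iff₀ (by positivity)]
      nlinarith
    have hD := abs_zetaZeroCount_sub_main_le_of_abs_zetaArgS_le hT2 (h₂ T hT hsmall)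
    linarith
  · -- `T ≥ T₀`: Theorem 1.3; the `Γ`-factor error is `≤ 1.2/(3T₀) < 10⁻³`
    have hErr : 1.2 / (π * T) ≤ 0.001 := by
      rw [div_le_iff₀ (by positivity)]
      nlinarith
    have hD := abs_zetaZeroCount_sub_main_le_of_abs_zetaArgS_le hT2 (h₁ T hlarge.le)
    nlinarith

/-- **Corollary 1.4 of Hasanalizade–Shen–Wong, first branch, from the same two inputs**: for
`T ≥ e`, `|S(T)| ≤ 0.1038 log T + 0.2573 log log T + 8.3675`.
[cite: HasanalizadeShenWong2022, Corollary 1.4] -/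
theorem abs_zetaArgS_le_hasanalizade_shen_wong_of_zetaArgS_bounds
    (h₁ : ∀ T : ℝ, 30610046000 ≤ T →
      |zetaArgS T| ≤ 0.103787 * Real.log T + 0.257297 * Real.log (Real.log T) + 8.367419)
    (h₂ : ∀ T : ℝ, Real.exp 1 ≤ T → T ≤ 30610046000 → |zetaArgS T| ≤ 2.5167) :
    ∀ T : ℝ, Real.exp 1 ≤ T →
      |zetaArgS T| ≤ 0.1038 * Real.log T + 0.2573 * Real.log (Real.log T) + 8.3675 := by
  intro T hT
  obtain ⟨hL1, hLL0⟩ := one_le_log_of_exp_one_le hT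
  rcases le_or_gt T 30610046000 with hsmall | hlarge
  · have hS := h₂ T hT hsmall
    nlinarith
  · have hS := h₁ T hlarge.le
    nlinarith

/-- **`S(T)` from the named fact.** Conversely, `zetaZeroCount_hasanalizade_shen_wong` yields, for
`T ≥ e`, `|S(T)| ≤ 0.1038 log T + 0.2573 log log T + 10.3831`
(`9.3675 + 7/8 + 1.2/(πe) = 10.3830…`). [cite: HasanalizadeShenWong2022, Corollary 1.2 and (5.5)] -/
theorem abs_zetaArgS_le_of_zetaZeroCount_hasanalizade_shen_wong
    (h : zetaZeroCount_hasanalizade_shen_wong) {T : ℝ} (hT : Real.exp 1 ≤ T) :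
    |zetaArgS T| ≤ 0.1038 * Real.log T + 0.2573 * Real.log (Real.log T) + 10.3831 := by
  have he := Real.exp_one_gt_d9
  have hπ3 := Real.pi_gt_d4
  have hπ := Real.pi_pos
  have hT2 : 2 ≤ T := by linarith
  have hErr : 1.2 / (π * T) ≤ 0.1406 := by
    rw [div_le_iff₀ (by positivity)]
    nlinarith
  have hS := abs_zetaArgS_le_of_abs_zetaZeroCount_sub_main_le hT2 (h T hT)
  linarith

end Literature.NumberTheory.LFunctions
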